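import Summits.Ventures.CertifiedManyBodySolver.Downfold.EmeryMonotoneVertexFloors
import HarnessLib

/-!
# Door 4 of the 3BE seam: trial-state CAPS transported over a delivered Emery box (affine in the couplings ⇒
# vertex rule), so that S2's two-sided energy WINDOWS bind a material's three-band box

Venture CertifiedManyBodySolver, cell `pub/hubbard-downfold` (stage S1 = ROUTER), seat hubbard-downfold-mod-4; namespace
`Summit.Ventures.CertifiedManyBodySolver.Downfold`. Sequel of `S2SeamEmery` (doors 1–3: ∀-on-box, vertex FLOORS by concavity,
Lipschitz budget) and `EmeryMonotoneVertexFloors` (lower-face rule). The phase-map words of the programme are energy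
WINDOWS; the floor half came through door 2; this file is the CAP half. For the decorated `CuO₂` model
(`EmeryThreeBandByDecoration`, hubbard-box-p1) any trial state `ω₀` of the class caps the variational energy by an AFFINE
function of the couplings (`emeryEnergyDensity_le_trial`):
`e(θ, ρ) ≤ trialCap ω₀ θ₀ θ := e_{M(θ₀)}(ω₀) + Σ_a (θ_a − θ₀_a)·e_{D_a}(ω₀)`.
An affine function on a coordinate box attains its maximum at a vertex, so:

* `trialCap`, `trialCap_affine` (the cap is affine along any segment), `convexOn_trialCap_line` (convex — indeed affine —
  along box-p1's physical line);
* **`emeryEnergyDensity_line_le_of_trial_vertices`** — if `trialCap ω₀ θ₀ (emeryLine s v) ≤ M` at the `64` vertices of a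
  six-box, then `e(emeryLine s q, ρ) ≤ M` on the whole box;
* **`holdsOn_emeryEnergyCap`** — the same as a box word of a typed `EmeryBox` through `emeryLineCoords`;
* **`holdsOn_emeryEnergyWindow`** — floors (door 2, 64 vertices — or use the lower-face file for 4) and caps (this door)
  combine to the two-sided window word `m ≤ e ≤ M` on the material's box.

Everything here is PROVED; no number about a material; the trial state, its energy and conjugate densities are S2's data.
-/

noncomputable section

namespace Summit.Ventures.CertifiedManyBodySolver.Downfold

open Matrix Finset Literature.Probability.LatticeModels
open Literature.MathematicalPhysics.QuantumLattice Literature.Computation.Certificates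
open scoped BigOperators

/-- **The trial cap** of a state `ω₀` anchored at `θ₀`: `e_{M(θ₀)}(ω₀) + Σ_a (θ_a − θ₀_a) e_{D_a}(ω₀)` — the right-hand side of
box-p1's `emeryEnergyDensity_le_trial`. [cite: KomaTasaki1994, §1] -/
def trialCap (ω₀ : InfVolFermionState 2) (θ₀ θ : Fin 14 → ℝ) : ℝ :=
  ω₀.cellEnergy (emeryViews θ₀) 1 + ∑ a, (θ a - θ₀ a) * ω₀.cellEnergy (emeryDirections a) 1

/-- The variational energy lies below the trial cap of any state of the class. [cite: KomaTasaki1994, §1] -/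
theorem emeryEnergyDensity_le_trialCap {ρ : ℝ} {ω₀ : InfVolFermionState 2} (hω₀ : ω₀ ∈ emeryStates ρ)
    (θ₀ θ : Fin 14 → ℝ) : emeryEnergyDensity θ ρ ≤ trialCap ω₀ θ₀ θ :=
  emeryEnergyDensity_le_trial hω₀ θ₀ θ

/-- **The trial cap is affine in the couplings**: along any two points, `cap(a•θ + b•θ') = a·cap θ + b·cap θ'` for
`a + b = 1`. [folklore] -/
theorem trialCap_affine (ω₀ : InfVolFermionState 2) (θ₀ θ θ' : Fin 14 → ℝ) {a b : ℝ} (hab : a + b = 1) :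
    trialCap ω₀ θ₀ (a • θ + b • θ') = a * trialCap ω₀ θ₀ θ + b * trialCap ω₀ θ₀ θ' := by
  unfold trialCap
  set C := ω₀.cellEnergy (emeryViews θ₀) 1 with hC
  have key : ∀ x, ((a • θ + b • θ') x - θ₀ x) * ω₀.cellEnergy (emeryDirections x) 1 =
      a * ((θ x - θ₀ x) * ω₀.cellEnergy (emeryDirections x) 1) +
        b * ((θ' x - θ₀ x) * ω₀.cellEnergy (emeryDirections x) 1) := by
    intro x
    have h1 : θ₀ x = (a + b) * θ₀ x := by rw [hab, one_mul]
    simp only [Pi.add_apply, Pi.smul_apply, smul_eq_mul]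
    conv_lhs => rw [h1]
    ring
  rw [Finset.sum_congr rfl (fun x _ => key x), Finset.sum_add_distrib, ← Finset.mul_sum, ← Finset.mul_sum]
  linear_combination (-C) * hab

/-- **The trial cap along box-p1's physical line is convex** (indeed affine: `emeryLine s` is linear). [folklore] -/
theorem convexOn_trialCap_line (ω₀ : InfVolFermionState 2) (θ₀ : Fin 14 → ℝ) (s : Fin 4 → ℝ) :
    ConvexOn ℝ Set.univ fun q : Fin 6 → ℝ => trialCap ω₀ θ₀ (emeryLine s q) := by
  refine ⟨convex_univ, fun x _ y _ a b _ _ hab => ?_⟩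
  show trialCap ω₀ θ₀ (emeryLine s (a • x + b • y)) ≤ a • trialCap ω₀ θ₀ (emeryLine s x) + b • trialCap ω₀ θ₀ (emeryLine s y)
  rw [map_add, LinearMap.map_smul, LinearMap.map_smul, trialCap_affine ω₀ θ₀ _ _ hab, smul_eq_mul, smul_eq_mul]

/-- **Vertex rule for caps**: if the trial cap is `≤ M` at the `64` vertices of a six-box (any sign pattern `s`), then the
variational energy is `≤ M` on the whole box. [cite: Rockafellar1970, Thm 32.2] -/
theorem emeryEnergyDensity_line_le_of_trial_vertices {ρ : ℝ} {ω₀ : InfVolFermionState 2} (hω₀ : ω₀ ∈ emeryStates ρ)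
    (θ₀ : Fin 14 → ℝ) (s : Fin 4 → ℝ) (lo hi : Fin 6 → ℝ) {M : ℝ}
    (hM : ∀ v ∈ Fintype.piFinset (fun k => ({lo k, hi k} : Finset ℝ)), trialCap ω₀ θ₀ (emeryLine s v) ≤ M)
    {q : Fin 6 → ℝ} (hq : q ∈ Set.Icc lo hi) : emeryEnergyDensity (emeryLine s q) ρ ≤ M :=
  (emeryEnergyDensity_le_trialCap hω₀ θ₀ _).trans
    (le_of_convexOn_of_forall_boxVertices (convexOn_trialCap_line ω₀ θ₀ s) lo hi hM hq)

/-- **A vertex-checked trial cap is a box word of the material's Emery box** (through the seam at reference level `εp`).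
[cite: Rockafellar1970, Thm 32.2] -/
theorem holdsOn_emeryEnergyCap {E : EmeryBox} {eA eB eD eUd eUp : Entry} {εp : ℚ}
    (hA : E .tpd = some eA) (hB : E .tpp = some eB) (hD : E .DeltaPd = some eD)
    (hUd : E .Udd = some eUd) (hUp : E .Upp = some eUp) {ρ : ℝ} {ω₀ : InfVolFermionState 2}
    (hω₀ : ω₀ ∈ emeryStates ρ) (θ₀ : Fin 14 → ℝ) (s : Fin 4 → ℝ) {M : ℝ}
    (hM : ∀ v ∈ Fintype.piFinset
        (fun k => ({emeryLo εp eA eB eD eUd eUp k, emeryHi εp eA eB eD eUd eUp k} : Finset ℝ)),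
      trialCap ω₀ θ₀ (emeryLine s v) ≤ M) :
    HoldsOn (fun p : EmeryCoord → ℝ =>
      emeryEnergyDensity (emeryLine s (emeryLineCoords (εp : ℝ) p)) ρ ≤ M) E :=
  holdsOn_of_forall_emeryLineBox hA hB hD hUd hUp
    (fun _ hq => emeryEnergyDensity_line_le_of_trial_vertices hω₀ θ₀ s _ _ hM hq)

/-- **TWO-SIDED ENERGY WINDOW on a material's Emery box**: floors certified at the 64 vertices (door 2) and a trial cap
checked at the same vertices (door 4) give `m ≤ e ≤ M` for every parameter vector of the box. [cite: Israel1979, Thm. I.3.4] -/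
theorem holdsOn_emeryEnergyWindow {E : EmeryBox} {eA eB eD eUd eUp : Entry} {εp : ℚ}
    (hA : E .tpd = some eA) (hB : E .tpp = some eB) (hD : E .DeltaPd = some eD)
    (hUd : E .Udd = some eUd) (hUp : E .Upp = some eUp) {ρ : ℝ} {ω₀ : InfVolFermionState 2}
    (hω₀ : ω₀ ∈ emeryStates ρ) (θ₀ : Fin 14 → ℝ) (s : Fin 4 → ℝ) {m M : ℝ}
    (hm : ∀ v ∈ Fintype.piFinset
        (fun k => ({emeryLo εp eA eB eD eUd eUp k, emeryHi εp eA eB eD eUd eUp k} : Finset ℝ)),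
      m ≤ emeryEnergyDensity (emeryLine s v) ρ)
    (hM : ∀ v ∈ Fintype.piFinset
        (fun k => ({emeryLo εp eA eB eD eUd eUp k, emeryHi εp eA eB eD eUd eUp k} : Finset ℝ)),
      trialCap ω₀ θ₀ (emeryLine s v) ≤ M) :
    HoldsOn (fun p : EmeryCoord → ℝ =>
      m ≤ emeryEnergyDensity (emeryLine s (emeryLineCoords (εp : ℝ) p)) ρ ∧
        emeryEnergyDensity (emeryLine s (emeryLineCoords (εp : ℝ) p)) ρ ≤ M) E :=
  fun p hp => ⟨holdsOn_emeryEnergyFloor hA hB hD hUd hUp s ρ hm p hp, holdsOn_emeryEnergyCap hA hB hD hUd hUp hω₀ θ₀ s hM p hp⟩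

end Summit.Ventures.CertifiedManyBodySolver.Downfold

end
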